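import Literature.NumberTheory.GelbartRogawski1991.LocalLineModelTransport
import Literature.NumberTheory.GelbartRogawski1991.LocalDoubledUnitaryDatum
import HarnessLib

/-!
# The scale-model transport `(a•T, δ) ≅ (T, δ/a)` of local Weil data, for ANY Gram matrix `T` and its multiple `T′ = a•T`

Topic `NumberTheory/GelbartRogawski1991`; namespace `Literature.NumberTheory.GelbartRogawski1991.UnitaryDualPair.LocalSplitting`.
KERNEL mathematics only: definitions with bodies + theorems; no named fact, no `sorry`.  Cell hodgecm-mathlib, line a4-liuD3
(`stub_iso_of_params`, step S6a), sequel of `LocalLineModelTransport`: there the transport is written for the PAIR Gram matrix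
`reindex e₁ e₁ (T_V ⊗ₖ (a))` of the undoubled dual pair; here the same transport is written for an arbitrary symmetric `T` and
a matrix `T′` with `T′ = a•T` (`hTT'`), so that it ALSO applies to the DOUBLED group `H = U(J ⊕ −J)`, whose Gram matrix
`gramD n (a•T_V) = a • gramD n T_V` is again a multiple (`gramD_smul`).  Everything is the same space `𝒮(F_vᴺ)` and the same
isometry `e′_a = lineScale (a ⊗ 1) : (x, y) ↦ (x, a•y)` (`LocalLineModelTransport.lineScale`):

* §1 `localGram_of_eq_smul`, `localPairing_of_eq_smul`: `𝕋′_v = a•𝕋_v`, `β_{T′}(x, y) = β_T(x, a•y)`; `polar_localPairing_lineScale_of_eq_smul`: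
  `e′_a` is an isometry `polar β_{T′} → polar β_T`; `localSchrodinger_of_eq_smul`: `ρ_{T′} = ρ_T ∘ H(e′_a)` ON THE NOSE;
  `implements_symplecticConj_lineScale_of_eq_smul`: the same operator implements `e′_a g e′_a⁻¹` for `ρ_T` iff it implements `g` for `ρ_{T′}`.
* §2 the unitary groups COINCIDE: `U(a•J)(F_v) = U(J)(F_v)` inside `Π_w GL_N(E_w)` (`localPi_eq_of_eq_smul`), whence the retyping
  isomorphism `scaleInl : U(J)(F_v) →* U(J′)(F_v)` (identity on matrices), and
  **`e′_a ∘ ι^{T′}_δ(scaleInl k) ∘ e′_a⁻¹ = ι^{T}_{δ/a}(k)`** (`symplecticConj_lineScale_iota_scaleInl`).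
* §3 the transported section `scaleTransportSection s′ : U(J)(F_v) →* S̃p_ψ(𝕎_v, β_T)` over `ι^T_{δ/a}` of a section `s′` over
  `ι^{T′}_δ`, with the SAME operators (`toRep_scaleTransportSection`; the operator is introduced through `Classical.choose`,
  `scaleTransportOp_def`, so that no definitional unfolding compares the two models).
* §4 the matrix identities feeding the doubled instance: `gram e₁ T_V (a) = a • T_V` (`gram_prodUnique_TW`),
  `gramD n (a • T) = a • gramD n T` (`gramD_smul`).

References: [MoeglinVignerasWaldspurger1987] Chap. 2 I.4, II.1 (A)–(B); [Weil1964] n° 5, n° 34; [GelbartRogawski1991] §3.1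
p. 454–455; [HarrisKudlaSweet1996] §1 (1.9); [Liu2021] App. D §D.1 Step 1–2.
-/

set_option autoImplicit false

noncomputable section

open scoped Matrix Kronecker
open NumberField IsDedekindDomain
open Literature.RepresentationTheory.HeisenbergGroup
open Literature.NumberTheory.Automorphic Literature.NumberTheory.Automorphic.UnitaryGroup
open Literature.NumberTheory.Automorphic.Liu2021.Def411WeilCarriers (TW JW JW_eq isSymm_TW)

namespace Literature.NumberTheory.GelbartRogawski1991.UnitaryDualPair.LocalSplitting

variable (F E : Type) [Field F] [NumberField F] [Field E] [NumberField E] [Algebra F E]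
  [Algebra.IsQuadraticExtension F E] (c : E ≃ₐ[F] E) (N : ℕ)
  {δ : E} (hcδ : c δ = -δ) (hδ : δ ≠ 0) {d : F} (hd : δ * δ = algebraMap F E d)
  (T T' : Matrix (Fin N) (Fin N) F) (hT : T.IsSymm) (hT' : T'.IsSymm) (a : Fˣ) (hTT' : T' = (a : F) • T)
  {J J' : Matrix (Fin N) (Fin N) E} (hJ : J = T.map (algebraMap F E)) (hJ' : J' = T'.map (algebraMap F E))
  (v : HeightOneSpectrum (𝓞 F))

/-! ## §1 Gram matrices, pairings, Schrödinger models of `T′ = a•T` versus `T` -/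

section Gram

include hTT' in
/-- `𝕋′_v = a • 𝕋_v` in `M_N(F_v)`. [cite: GelbartRogawski1991, §3.1 p. 454] -/
theorem localGram_of_eq_smul : localGram F N T' v = algebraMap F (v.adicCompletion F) (a : F) • localGram F N T v := by
  refine Matrix.ext fun i j => ?_
  rw [hTT']
  simp only [localGram, Matrix.map_apply, Matrix.smul_apply, smul_eq_mul, map_mul]

include hTT' in
/-- `β_{T′} = a • β_T` as bilinear maps. [cite: Weil1964, n° 34, p. 182] -/
theorem localPairing_of_eq_smul_eq :
    localPairing F N T' v = algebraMap F (v.adicCompletion F) (a : F) • localPairing F N T v := by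
  change Matrix.toLinearMap₂' (v.adicCompletion F) (localGram F N T' v) = _
  rw [localGram_of_eq_smul F N T T' a hTT' v, map_smul]

include hTT' in
/-- **`β_{T′}(x, y) = β_T(x, a•y)`**. [cite: Weil1964, n° 34, p. 182] -/
theorem localPairing_of_eq_smul (x y : Fin N → v.adicCompletion F) :
    localPairing F N T' v x y = localPairing F N T v x (algebraMap F (v.adicCompletion F) (a : F) • y) := by
  rw [localPairing_of_eq_smul_eq F N T T' a hTT' v, LinearMap.smul_apply, LinearMap.smul_apply, LinearMap.map_smul]

include hTT' in
/-- **`e′_a` is an isometry `polar β_{T′} → polar β_T`**. [cite: Weil1964, n° 5, p. 150; n° 34, p. 182] -/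
theorem polar_localPairing_lineScale_of_eq_smul (p q : (Fin N → v.adicCompletion F) × (Fin N → v.adicCompletion F)) :
    polar (localPairing F N T v) (lineScale (unitAt F a v) p) (lineScale (unitAt F a v) q) = polar (localPairing F N T' v) p q := by
  rw [polar_apply, polar_apply, lineScale_apply, lineScale_apply, localPairing_of_eq_smul F N T T' a hTT' v]
  rfl

include hTT' in
/-- **`ρ_{T′} = ρ_T ∘ H(e′_a)` on `𝒮(F_vᴺ)`** (same formula `Φ ↦ ψ(t + ⟨u, T(a y)⟩) Φ(u + x)`).
[cite: MoeglinVignerasWaldspurger1987, Chap. 2 I.4 Exemple (1); Weil1964, n° 34, p. 182] -/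
theorem localSchrodinger_of_eq_smul (h : Heisenberg (polar (localPairing F N T' v))) :
    localSchrodinger F N T' v h =
      localSchrodinger F N T v
        (Heisenberg.mapEquiv (lineScale (unitAt F a v)) (polar_localPairing_lineScale_of_eq_smul F N T T' a hTT' v) h) := by
  refine LinearMap.ext fun f => Subtype.ext (funext fun u => ?_)
  change ((schrodingerSB _ _ _ _ h f : SchwartzBruhat _) : _ → ℂ) u =
    ((schrodingerSB _ _ _ _ _ f : SchwartzBruhat _) : _ → ℂ) u
  rw [schrodingerSB_apply, schrodingerSB_apply, Heisenberg.mapEquiv_t, Heisenberg.mapEquiv_v, lineScale_apply,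
    localPairing_of_eq_smul F N T T' a hTT' v]
  rfl

include hTT' in
/-- **same-space transport of implementers**: for `(g, M) ∈ S̃p_ψ(𝕎_v, β_{T′})`, the SAME operator `M` implements
`e′_a g e′_a⁻¹` for the Schrödinger model of `β_T`. [cite: MoeglinVignerasWaldspurger1987, Chap. 2 II.1 (A)–(B); Weil1964, n° 34, p. 182] -/
theorem implements_symplecticConj_lineScale_of_eq_smul (m : LocalMp F N T' v) :
    Implements (localSchrodinger F N T v)
      (ofSymplectic _ (symplecticConj (lineScale (unitAt F a v)) (polar_localPairing_lineScale_of_eq_smul F N T T' a hTT' v) m.1.1))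
      m.1.2 :=
  (implements_iff_implements_symplecticConj (lineScale (unitAt F a v))
    (polar_localPairing_lineScale_of_eq_smul F N T T' a hTT' v) (localSchrodinger_of_eq_smul F N T T' a hTT' v) _ _).1
    ((mem_MpPsi _ _).1 m.2)

include hTT' in
/-- conversely, an implementer of `g` for `ρ_T` implements `e′_a⁻¹ g e′_a` for `ρ_{T′}` — stated as: `(e′_a⁻¹-conjugate, M) ∈ S̃p_ψ(β_{T′})`
iff `(g, M) ∈ S̃p_ψ(β_T)` read through `symplecticConj`. [cite: MoeglinVignerasWaldspurger1987, Chap. 2 II.1 (A)–(B)] -/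
theorem implements_iff_implements_symplecticConj_lineScale_of_eq_smul (g : LocalSp F N T' v)
    (M : SchwartzBruhat (Fin N → v.adicCompletion F) ≃ₗ[ℂ] SchwartzBruhat (Fin N → v.adicCompletion F)) :
    Implements (localSchrodinger F N T v)
        (ofSymplectic _ (symplecticConj (lineScale (unitAt F a v)) (polar_localPairing_lineScale_of_eq_smul F N T T' a hTT' v) g)) M ↔
      Implements (localSchrodinger F N T' v) (ofSymplectic _ g) M :=
  (implements_iff_implements_symplecticConj (lineScale (unitAt F a v))
    (polar_localPairing_lineScale_of_eq_smul F N T T' a hTT' v) (localSchrodinger_of_eq_smul F N T T' a hTT' v) g M).symm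

end Gram

/-! ## §2 The unitary groups coincide; the embeddings correspond under `e′_a` -/

section Unitary

omit [NumberField F] [NumberField E] [Algebra.IsQuadraticExtension F E] in
include hTT' hJ hJ' in
/-- `J′ = a • J` in `M_N(E)`. [cite: GelbartRogawski1991, §3.1 p. 454] -/
theorem herm_of_eq_smul : J' = algebraMap F E (a : F) • J := by
  rw [hJ', hJ, hTT']
  refine Matrix.ext fun i j => ?_
  simp only [Matrix.map_apply, Matrix.smul_apply, smul_eq_mul, map_mul]

omit [NumberField F] [Algebra.IsQuadraticExtension F E] in
/-- the unitarity condition is insensitive to a non-zero scalar on the form: `Xᵀ (t•P) Y = t•P ↔ Xᵀ P Y = P`. [folklore] -/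
private theorem conjTranspose_mul_smul_form_iff {L : Type*} [Field L] {t : L} (ht : t ≠ 0) (X P Y : Matrix (Fin N) (Fin N) L) :
    X * (t • P) * Y = t • P ↔ X * P * Y = P := by
  rw [Matrix.mul_smul, Matrix.smul_mul]
  exact smul_right_injective _ ht |>.eq_iff

omit [Algebra.IsQuadraticExtension F E] in
include hTT' hJ hJ' in
/-- **`U(J′)(F_v) = U(J)(F_v)`** as subgroups of `Π_{w ∣ v} GL_N(E_w)` (`J′ = a•J`, `a ≠ 0`).
[cite: GelbartRogawski1991, §3.1 p. 454] [cite: PlatonovRapinchuk1994, §5.1] -/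
theorem localPi_eq_of_eq_smul : localPi E c N J' v = localPi E c N J v := by
  ext u
  rw [mem_localPi_iff, mem_localPi_iff]
  refine forall_congr' fun w => ?_
  have hP : placeForm J' w.1 = algebraMap E (w.1.adicCompletion E) (algebraMap F E (a : F)) • placeForm J w.1 := by
    rw [placeForm, placeForm, herm_of_eq_smul F E N T T' a hTT' hJ hJ']
    refine Matrix.ext fun i j => ?_
    simp only [Matrix.map_apply, Matrix.smul_apply, smul_eq_mul, map_mul]
  have ht : algebraMap E (w.1.adicCompletion E) (algebraMap F E (a : F)) ≠ 0 :=
    (map_ne_zero _).2 ((map_ne_zero _).2 a.ne_zero)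
  rw [hP, conjTranspose_mul_smul_form_iff N ht]

omit [Algebra.IsQuadraticExtension F E] in
/-- **the retyping homomorphism `scaleInl : U(J)(F_v) →* U(J′)(F_v)`** (identity on the underlying families of matrices;
the two subgroups of `Π_w GL_N(E_w)` coincide, `localPi_eq_of_eq_smul`). [cite: GelbartRogawski1991, §3.1 p. 454] -/
def scaleInl : localPi E c N J v →* localPi E c N J' v where
  toFun k := ⟨(k : LocalGLPi E N v), by rw [localPi_eq_of_eq_smul F E c N T T' a hTT' hJ hJ' v]; exact k.2⟩
  map_one' := rfl
  map_mul' _ _ := rfl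

omit [Algebra.IsQuadraticExtension F E] in
/-- the inverse retyping `U(J′)(F_v) →* U(J)(F_v)`. [cite: GelbartRogawski1991, §3.1 p. 454] -/
def scaleInv : localPi E c N J' v →* localPi E c N J v where
  toFun k := ⟨(k : LocalGLPi E N v), by rw [← localPi_eq_of_eq_smul F E c N T T' a hTT' hJ hJ' v]; exact k.2⟩
  map_one' := rfl
  map_mul' _ _ := rfl

omit [Algebra.IsQuadraticExtension F E] in
/-- underlying family: `scaleInl k = k` (kernel hygiene: proved through the defining `Subtype.mk`, never by a bare `rfl`
between subtypes of different subgroups). [cite: GelbartRogawski1991, §3.1 p. 454] -/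
theorem coe_scaleInl (k : localPi E c N J v) :
    ((scaleInl F E c N T T' a hTT' hJ hJ' v k : localPi E c N J' v) : LocalGLPi E N v) = (k : LocalGLPi E N v) := by
  have hk : (k : LocalGLPi E N v) ∈ localPi E c N J' v := by rw [localPi_eq_of_eq_smul F E c N T T' a hTT' hJ hJ' v]; exact k.2
  have e : scaleInl F E c N T T' a hTT' hJ hJ' v k = ⟨(k : LocalGLPi E N v), hk⟩ := rfl
  rw [e]

omit [Algebra.IsQuadraticExtension F E] in
/-- underlying family: `scaleInv k = k`. [cite: GelbartRogawski1991, §3.1 p. 454] -/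
theorem coe_scaleInv (k : localPi E c N J' v) :
    ((scaleInv F E c N T T' a hTT' hJ hJ' v k : localPi E c N J v) : LocalGLPi E N v) = (k : LocalGLPi E N v) := by
  have hk : (k : LocalGLPi E N v) ∈ localPi E c N J v := by rw [← localPi_eq_of_eq_smul F E c N T T' a hTT' hJ hJ' v]; exact k.2
  have e : scaleInv F E c N T T' a hTT' hJ hJ' v k = ⟨(k : LocalGLPi E N v), hk⟩ := rfl
  rw [e]

omit [Algebra.IsQuadraticExtension F E] in
/-- `scaleInv ∘ scaleInl = id`. [cite: GelbartRogawski1991, §3.1 p. 454] -/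
theorem scaleInv_scaleInl (k : localPi E c N J v) :
    scaleInv F E c N T T' a hTT' hJ hJ' v (scaleInl F E c N T T' a hTT' hJ hJ' v k) = k :=
  Subtype.ext (by rw [coe_scaleInv, coe_scaleInl])

omit [Algebra.IsQuadraticExtension F E] in
/-- `scaleInl ∘ scaleInv = id`. [cite: GelbartRogawski1991, §3.1 p. 454] -/
theorem scaleInl_scaleInv (k : localPi E c N J' v) :
    scaleInl F E c N T T' a hTT' hJ hJ' v (scaleInv F E c N T T' a hTT' hJ hJ' v k) = k :=
  Subtype.ext (by rw [coe_scaleInl, coe_scaleInv])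

omit [Algebra.IsQuadraticExtension F E] in
/-- `scaleInl` is continuous (it is the identity on the ambient `Π_w GL_N(E_w)`). [cite: PlatonovRapinchuk1994, §5.1] -/
theorem continuous_scaleInl : Continuous (scaleInl F E c N T T' a hTT' hJ hJ' v) := by
  refine Continuous.subtype_mk (f := fun k : localPi E c N J v => (k : LocalGLPi E N v)) continuous_subtype_val _

omit [Algebra.IsQuadraticExtension F E] in
/-- the regrouped matrices over `E ⊗ F_v` agree: `localPiEquiv (scaleInl k) = localPiEquiv k` in `GL_N(E ⊗ F_v)`.
[cite: MoeglinVignerasWaldspurger1987, Chap. 1 I.17] -/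
theorem coe_localPiEquiv_scaleInl (k : localPi E c N J v) :
    ((localPiEquiv E c N J' v (scaleInl F E c N T T' a hTT' hJ hJ' v k) : «local» E c N J' v) : GL (Fin N) (LocalRing E v)) =
      ((localPiEquiv E c N J v k : «local» E c N J v) : GL (Fin N) (LocalRing E v)) := by
  rw [coe_localPiEquiv_apply, coe_localPiEquiv_apply, coe_scaleInl]

/-- **The transport carries `ι^{T′}_δ ∘ scaleInl` to `ι^{T}_{δ/a}`**: `e′_a ∘ ι^{T′}_δ(k) ∘ e′_a⁻¹ = ι^{T}_{δ/a}(k)` in `Sp(𝕎_v, β_T)`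
— both are `u ↦ k u` on `E_vᴺ`, read in the coordinates `(x, a y)` of `u = x + δ y = x + (δ/a)(a y)`.
[cite: MoeglinVignerasWaldspurger1987, Ch. 1 I.17; GelbartRogawski1991, §3.1 p. 454] -/
theorem symplecticConj_lineScale_iota_scaleInl (k : localPi E c N J v) :
    symplecticConj (lineScale (unitAt F a v)) (polar_localPairing_lineScale_of_eq_smul F N T T' a hTT' v)
        (iota F E c N hcδ hδ hd T' hT' hJ' v (scaleInl F E c N T T' a hTT' hJ hJ' v k)) =
      iota F E c N (conj_lineDelta hcδ a) (lineDelta_ne_zero hδ a) (lineDelta_mul_self hd a) T hT hJ v k := by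
  apply Subtype.ext
  refine LinearEquiv.ext fun w => ?_
  rw [symplecticConj_apply, iota_def, iota_def]
  change lineScale (unitAt F a v) ((localToSymplectic E c N v hcδ hδ hd hT' hJ'
      (localPiEquiv E c N _ v (scaleInl F E c N T T' a hTT' hJ hJ' v k))).1 ((lineScale (unitAt F a v)).symm w)) =
    (localToSymplectic E c N v (conj_lineDelta hcδ a) (lineDelta_ne_zero hδ a) (lineDelta_mul_self hd a) hT hJ
      (localPiEquiv E c N J v k)).1 w
  set x := (QuadraticCoordinates.reIm (quadraticLocalEquiv E v c hcδ hδ).toLinearEquiv.toAddEquiv (Fin N)).symm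
    ((lineScale (unitAt F a v)).symm w) with hx
  have hw₁ : (lineScale (unitAt F a v)).symm w =
      QuadraticCoordinates.reIm (quadraticLocalEquiv E v c hcδ hδ).toLinearEquiv.toAddEquiv (Fin N) x := by
    rw [hx, AddEquiv.apply_symm_apply]
  have hw₂ : w = QuadraticCoordinates.reIm
      (quadraticLocalEquiv E v c (conj_lineDelta hcδ a) (lineDelta_ne_zero hδ a)).toLinearEquiv.toAddEquiv (Fin N) x := by
    rw [reIm_lineDelta_apply (hcδ := hcδ) (hδ := hδ), ← hw₁, LinearEquiv.apply_symm_apply]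
  rw [hw₁, localToSymplectic_reIm, hw₂, localToSymplectic_reIm, reIm_lineDelta_apply (hcδ := hcδ) (hδ := hδ),
    coe_localPiEquiv_scaleInl]

end Unitary

/-! ## §3 The transported section and its operators -/

section Section

variable (s' : localPi E c N J' v →* LocalMp F N T' v)

omit [Algebra.IsQuadraticExtension F E] in
/-- (kernel hygiene) the operator of `s′(scaleInl g)` exists with its defining equation. [cite: MoeglinVignerasWaldspurger1987, Chap. 2 II.1 (A)] -/
private theorem exists_eq_scaleTransportOp (g : localPi E c N J v) :
    ∃ M : SchwartzBruhat (Fin N → v.adicCompletion F) ≃ₗ[ℂ] SchwartzBruhat (Fin N → v.adicCompletion F),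
      M = (s' (scaleInl F E c N T T' a hTT' hJ hJ' v g)).1.2 :=
  ⟨_, rfl⟩

omit [Algebra.IsQuadraticExtension F E] in
/-- **the operator `M(s′(g))` of `𝒮(F_vᴺ)`** attached to `g ∈ U(J)(F_v)` by the `T′`-model section `s′` (through `Classical.choose`,
definitionally inert; unfold with `scaleTransportOp_def`). [cite: MoeglinVignerasWaldspurger1987, Chap. 2 II.1 (A)] -/
def scaleTransportOp (g : localPi E c N J v) :
    SchwartzBruhat (Fin N → v.adicCompletion F) ≃ₗ[ℂ] SchwartzBruhat (Fin N → v.adicCompletion F) :=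
  Classical.choose (exists_eq_scaleTransportOp F E c N T T' a hTT' hJ hJ' v s' g)

omit [Algebra.IsQuadraticExtension F E] in
/-- unfolding equation of `scaleTransportOp`. [cite: MoeglinVignerasWaldspurger1987, Chap. 2 II.1 (A)] -/
theorem scaleTransportOp_def (g : localPi E c N J v) :
    scaleTransportOp F E c N T T' a hTT' hJ hJ' v s' g = (s' (scaleInl F E c N T T' a hTT' hJ hJ' v g)).1.2 :=
  Classical.choose_spec (exists_eq_scaleTransportOp F E c N T T' a hTT' hJ hJ' v s' g)

omit [Algebra.IsQuadraticExtension F E] in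
/-- `M(s′(g)) = toOp (s′(scaleInl g))`. [cite: MoeglinVignerasWaldspurger1987, Chap. 2 II.1 (A)] -/
theorem toOp_eq_scaleTransportOp (g : localPi E c N J v) :
    MpPsi.toOp _ (s' (scaleInl F E c N T T' a hTT' hJ hJ' v g)) = scaleTransportOp F E c N T T' a hTT' hJ hJ' v s' g := by
  rw [scaleTransportOp_def, MpPsi.toOp_apply]

/-- **The transported section** `s(g) := (ι^{T}_{δ/a}(g), M(s′(g))) : U(J)(F_v) →* S̃p_ψ(𝕎_v, β_T)` of a section `s′` over `ι^{T′}_δ`.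
[cite: MoeglinVignerasWaldspurger1987, Chap. 2 II.1; Chap. 3 I.1] -/
def scaleTransportSection (hs' : ∀ g, MpPsi.proj _ (s' g) = iota F E c N hcδ hδ hd T' hT' hJ' v g) :
    localPi E c N J v →* LocalMp F N T v where
  toFun g := ⟨(iota F E c N (conj_lineDelta hcδ a) (lineDelta_ne_zero hδ a) (lineDelta_mul_self hd a) T hT hJ v g,
      scaleTransportOp F E c N T T' a hTT' hJ hJ' v s' g), by
    rw [mem_MpPsi]
    dsimp only
    have h := implements_symplecticConj_lineScale_of_eq_smul F N T T' a hTT' v (s' (scaleInl F E c N T T' a hTT' hJ hJ' v g))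
    have hproj : symplecticConj (lineScale (unitAt F a v)) (polar_localPairing_lineScale_of_eq_smul F N T T' a hTT' v)
        (s' (scaleInl F E c N T T' a hTT' hJ hJ' v g)).1.1 =
        iota F E c N (conj_lineDelta hcδ a) (lineDelta_ne_zero hδ a) (lineDelta_mul_self hd a) T hT hJ v g := by
      have h1 := hs' (scaleInl F E c N T T' a hTT' hJ hJ' v g)
      rw [MpPsi.proj_apply] at h1
      rw [h1]
      exact symplecticConj_lineScale_iota_scaleInl F E c N hcδ hδ hd T T' hT hT' a hTT' hJ hJ' v g
    have hop : (s' (scaleInl F E c N T T' a hTT' hJ hJ' v g)).1.2 = scaleTransportOp F E c N T T' a hTT' hJ hJ' v s' g :=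
      (scaleTransportOp_def F E c N T T' a hTT' hJ hJ' v s' g).symm
    rw [hproj, hop] at h
    exact h⟩
  map_one' := Subtype.ext (Prod.ext (map_one _) (by
    change scaleTransportOp F E c N T T' a hTT' hJ hJ' v s' 1 = 1
    rw [scaleTransportOp_def, map_one, map_one]
    rfl))
  map_mul' g g' := Subtype.ext (Prod.ext (map_mul _ g g') (by
    change scaleTransportOp F E c N T T' a hTT' hJ hJ' v s' (g * g') =
      scaleTransportOp F E c N T T' a hTT' hJ hJ' v s' g * scaleTransportOp F E c N T T' a hTT' hJ hJ' v s' g'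
    rw [scaleTransportOp_def, scaleTransportOp_def, scaleTransportOp_def, map_mul, map_mul]
    rfl))

variable (hs' : ∀ g, MpPsi.proj _ (s' g) = iota F E c N hcδ hδ hd T' hT' hJ' v g)

/-- **`s` is a section over `ι^{T}_{δ/a}`**. [cite: MoeglinVignerasWaldspurger1987, Chap. 2 II.1 (B); Ch. 1 I.17] -/
theorem proj_scaleTransportSection (g : localPi E c N J v) :
    MpPsi.proj _ (scaleTransportSection F E c N hcδ hδ hd T T' hT hT' a hTT' hJ hJ' v s' hs' g) =
      iota F E c N (conj_lineDelta hcδ a) (lineDelta_ne_zero hδ a) (lineDelta_mul_self hd a) T hT hJ v g := rfl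

/-- the operator of `s(g)` is `M(s′(g))`. [cite: MoeglinVignerasWaldspurger1987, Chap. 2 II.1 (A)] -/
theorem toOp_scaleTransportSection_eq_scaleTransportOp (g : localPi E c N J v) :
    MpPsi.toOp _ (scaleTransportSection F E c N hcδ hδ hd T T' hT hT' a hTT' hJ hJ' v s' hs' g) =
      scaleTransportOp F E c N T T' a hTT' hJ hJ' v s' g := rfl

/-- **the operators are unchanged**: `toOp (s g) = toOp (s′(scaleInl g))`. [cite: MoeglinVignerasWaldspurger1987, Chap. 2 II.1 (A)] -/
theorem toOp_scaleTransportSection (g : localPi E c N J v) :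
    MpPsi.toOp _ (scaleTransportSection F E c N hcδ hδ hd T T' hT hT' a hTT' hJ hJ' v s' hs' g) =
      MpPsi.toOp _ (s' (scaleInl F E c N T T' a hTT' hJ hJ' v g)) :=
  (toOp_scaleTransportSection_eq_scaleTransportOp F E c N hcδ hδ hd T T' hT hT' a hTT' hJ hJ' v s' hs' g).trans
    (toOp_eq_scaleTransportOp F E c N T T' a hTT' hJ hJ' v s' g).symm

/-- **the Weil operators are unchanged**: `ω_s(g) = ω_{s′}(scaleInl g)` as operators of `𝒮(F_vᴺ)`.
[cite: MoeglinVignerasWaldspurger1987, Chap. 2 II.1 (A)] -/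
theorem toRep_scaleTransportSection (g : localPi E c N J v) :
    MpPsi.toRep _ (scaleTransportSection F E c N hcδ hδ hd T T' hT hT' a hTT' hJ hJ' v s' hs' g) =
      MpPsi.toRep _ (s' (scaleInl F E c N T T' a hTT' hJ hJ' v g)) := by
  have h₁ : MpPsi.toRep _ (scaleTransportSection F E c N hcδ hδ hd T T' hT hT' a hTT' hJ hJ' v s' hs' g) =
      LinearEquiv.automorphismGroup.toLinearMapMonoidHom
        (MpPsi.toOp _ (scaleTransportSection F E c N hcδ hδ hd T T' hT hT' a hTT' hJ hJ' v s' hs' g)) := rfl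
  have h₂ : MpPsi.toRep _ (s' (scaleInl F E c N T T' a hTT' hJ hJ' v g)) =
      LinearEquiv.automorphismGroup.toLinearMapMonoidHom (MpPsi.toOp _ (s' (scaleInl F E c N T T' a hTT' hJ hJ' v g))) := rfl
  rw [h₁, h₂, toOp_scaleTransportSection F E c N hcδ hδ hd T T' hT hT' a hTT' hJ hJ' v s' hs' g]

/-- **`ω_s = ω_{s′} ∘ scaleInl`** as representations of `U(J)(F_v)` on `𝒮(F_vᴺ)`. [cite: MoeglinVignerasWaldspurger1987, Chap. 2 II.1; Chap. 3 I.1] -/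
theorem omega_scaleTransportSection :
    (MpPsi.toRep (localSchrodinger F N T v)).comp (scaleTransportSection F E c N hcδ hδ hd T T' hT hT' a hTT' hJ hJ' v s' hs') =
      (show Representation ℂ (localPi E c N J v) (SchwartzBruhat (Fin N → v.adicCompletion F)) from
        ((MpPsi.toRep (localSchrodinger F N T' v)).comp s').comp (scaleInl F E c N T T' a hTT' hJ hJ' v)) :=
  MonoidHom.ext fun g => by
    change MpPsi.toRep _ (scaleTransportSection F E c N hcδ hδ hd T T' hT hT' a hTT' hJ hJ' v s' hs' g) =
      MpPsi.toRep _ (s' (scaleInl F E c N T T' a hTT' hJ hJ' v g))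
    exact toRep_scaleTransportSection F E c N hcδ hδ hd T T' hT hT' a hTT' hJ hJ' v s' hs' g

omit [Algebra.IsQuadraticExtension F E] in
/-- **the transported ELEMENT** `(e′_a π(m) e′_a⁻¹, M)` of `S̃p_ψ(β_T)` attached to `m = (π(m), M) ∈ S̃p_ψ(β_{T′})` (same operator).
[cite: MoeglinVignerasWaldspurger1987, Chap. 2 II.1 (A)–(B)] -/
def scaleTransportElt (m : LocalMp F N T' v) : LocalMp F N T v :=
  ⟨(symplecticConj (lineScale (unitAt F a v)) (polar_localPairing_lineScale_of_eq_smul F N T T' a hTT' v) m.1.1, m.1.2), by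
    rw [mem_MpPsi]
    exact implements_symplecticConj_lineScale_of_eq_smul F N T T' a hTT' v m⟩

omit [Algebra.IsQuadraticExtension F E] in
/-- components of the transported element. [cite: MoeglinVignerasWaldspurger1987, Chap. 2 II.1 (A)–(B)] -/
theorem coe_scaleTransportElt (m : LocalMp F N T' v) :
    ((scaleTransportElt F N T T' a hTT' v m : LocalMp F N T v) :
        LocalSp F N T v × (SchwartzBruhat (Fin N → v.adicCompletion F) ≃ₗ[ℂ] SchwartzBruhat (Fin N → v.adicCompletion F))) =
      (symplecticConj (lineScale (unitAt F a v)) (polar_localPairing_lineScale_of_eq_smul F N T T' a hTT' v) m.1.1, m.1.2) := rfl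

omit [Algebra.IsQuadraticExtension F E] in
/-- projection of the transported element: `e′_a π(m) e′_a⁻¹`. [cite: MoeglinVignerasWaldspurger1987, Chap. 2 II.1 (B)] -/
theorem proj_scaleTransportElt (m : LocalMp F N T' v) :
    MpPsi.proj _ (scaleTransportElt F N T T' a hTT' v m) =
      symplecticConj (lineScale (unitAt F a v)) (polar_localPairing_lineScale_of_eq_smul F N T T' a hTT' v) (MpPsi.proj _ m) := by
  rw [MpPsi.proj_apply, MpPsi.proj_apply, coe_scaleTransportElt]

omit [Algebra.IsQuadraticExtension F E] in
/-- operator of the transported element: unchanged. [cite: MoeglinVignerasWaldspurger1987, Chap. 2 II.1 (A)] -/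
theorem toOp_scaleTransportElt (m : LocalMp F N T' v) :
    MpPsi.toOp _ (scaleTransportElt F N T T' a hTT' v m) = MpPsi.toOp _ m := by
  rw [MpPsi.toOp_apply, MpPsi.toOp_apply, coe_scaleTransportElt]

omit [Algebra.IsQuadraticExtension F E] in
/-- Weil operator of the transported element: unchanged. [cite: MoeglinVignerasWaldspurger1987, Chap. 2 II.1 (A)] -/
theorem toRep_scaleTransportElt (m : LocalMp F N T' v) :
    MpPsi.toRep _ (scaleTransportElt F N T T' a hTT' v m) = MpPsi.toRep _ m := by
  refine LinearMap.ext fun f => ?_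
  rw [MpPsi.toRep_apply, MpPsi.toRep_apply, coe_scaleTransportElt]

set_option maxHeartbeats 400000 in
omit [Algebra.IsQuadraticExtension F E] in
/-- `scaleTransportElt` is multiplicative. [cite: MoeglinVignerasWaldspurger1987, Chap. 2 II.1 (B)] -/
theorem scaleTransportElt_mul (m m' : LocalMp F N T' v) :
    scaleTransportElt F N T T' a hTT' v (m * m') = scaleTransportElt F N T T' a hTT' v m * scaleTransportElt F N T T' a hTT' v m' := by
  refine Subtype.ext ?_
  rw [Subgroup.coe_mul, coe_scaleTransportElt, coe_scaleTransportElt, coe_scaleTransportElt, Subgroup.coe_mul, Prod.fst_mul,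
    Prod.snd_mul, map_mul, Prod.mk_mul_mk]

omit [Algebra.IsQuadraticExtension F E] in
/-- `scaleTransportElt` preserves inverses. [cite: MoeglinVignerasWaldspurger1987, Chap. 2 II.1 (B)] -/
theorem scaleTransportElt_inv (m : LocalMp F N T' v) :
    scaleTransportElt F N T T' a hTT' v m⁻¹ = (scaleTransportElt F N T T' a hTT' v m)⁻¹ := by
  refine Subtype.ext ?_
  rw [Subgroup.coe_inv, coe_scaleTransportElt, coe_scaleTransportElt, Subgroup.coe_inv, Prod.fst_inv, Prod.snd_inv, map_inv,
    Prod.inv_mk]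

/-- components of the transported section at `g`. [cite: MoeglinVignerasWaldspurger1987, Chap. 2 II.1] -/
theorem coe_scaleTransportSection_apply (g : localPi E c N J v) :
    ((scaleTransportSection F E c N hcδ hδ hd T T' hT hT' a hTT' hJ hJ' v s' hs' g : LocalMp F N T v) :
        LocalSp F N T v × (SchwartzBruhat (Fin N → v.adicCompletion F) ≃ₗ[ℂ] SchwartzBruhat (Fin N → v.adicCompletion F))) =
      (iota F E c N (conj_lineDelta hcδ a) (lineDelta_ne_zero hδ a) (lineDelta_mul_self hd a) T hT hJ v g,
        scaleTransportOp F E c N T T' a hTT' hJ hJ' v s' g) := rfl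

/-- **the transported section is the transported element of `s′(scaleInl g)`**. [cite: MoeglinVignerasWaldspurger1987, Chap. 2 II.1] -/
theorem scaleTransportSection_apply (g : localPi E c N J v) :
    scaleTransportSection F E c N hcδ hδ hd T T' hT hT' a hTT' hJ hJ' v s' hs' g =
      scaleTransportElt F N T T' a hTT' v (s' (scaleInl F E c N T T' a hTT' hJ hJ' v g)) := by
  refine Subtype.ext ?_
  rw [coe_scaleTransportSection_apply, coe_scaleTransportElt, Prod.mk.injEq]
  refine ⟨?_, scaleTransportOp_def F E c N T T' a hTT' hJ hJ' v s' g⟩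
  have h1 := hs' (scaleInl F E c N T T' a hTT' hJ hJ' v g)
  rw [MpPsi.proj_apply] at h1
  rw [h1, symplecticConj_lineScale_iota_scaleInl]

/-- **conjugation commutes with the transport**: `ω(M s(g) M⁻¹) = ω(m s′(scaleInl g) m⁻¹)` for `M = scaleTransportElt m`
(same operators on both sides). [cite: MoeglinVignerasWaldspurger1987, Chap. 2 II.1 (A)] -/
theorem toRep_conj_scaleTransportSection (m : LocalMp F N T' v) (g : localPi E c N J v) :
    MpPsi.toRep _ (scaleTransportElt F N T T' a hTT' v m * scaleTransportSection F E c N hcδ hδ hd T T' hT hT' a hTT' hJ hJ' v s' hs' g *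
        (scaleTransportElt F N T T' a hTT' v m)⁻¹) =
      MpPsi.toRep _ (m * s' (scaleInl F E c N T T' a hTT' hJ hJ' v g) * m⁻¹) := by
  -- (kernel/elaborator hygiene: rewrite only along patterns keyed on the `T`-model constants, never search the
  -- `T′`-model products for a `T`-model pattern)
  have e1 : scaleTransportElt F N T T' a hTT' v m * scaleTransportSection F E c N hcδ hδ hd T T' hT hT' a hTT' hJ hJ' v s' hs' g *
        (scaleTransportElt F N T T' a hTT' v m)⁻¹ =
      scaleTransportElt F N T T' a hTT' v (m * s' (scaleInl F E c N T T' a hTT' hJ hJ' v g) * m⁻¹) := by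
    rw [scaleTransportElt_mul, scaleTransportElt_mul, scaleTransportElt_inv, scaleTransportSection_apply]
  rw [e1, toRep_scaleTransportElt]

end Section

/-! ## §4 Matrix identities for the instances (pair Gram at `Equiv.prodUnique`; the doubled Gram is linear) -/

section Instances

omit [NumberField F] in
/-- `gram e₁ T_V (a) = a • T_V` for `e₁ = Equiv.prodUnique` (entries `T_{ij} · a`). [cite: GelbartRogawski1991, §3.1 p. 454] -/
theorem gram_prodUnique_TW (TV : Matrix (Fin N) (Fin N) F) :
    gram F (Equiv.prodUnique (Fin N) (Fin 1)) TV (TW F a) = (a : F) • TV := by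
  refine Matrix.ext fun i j => ?_
  change (TV ⊗ₖ TW F a) ((Equiv.prodUnique (Fin N) (Fin 1)).symm i) ((Equiv.prodUnique (Fin N) (Fin 1)).symm j) = (a : F) * TV i j
  have hTW : ∀ i' j' : Fin 1, TW F a i' j' = (a : F) := fun i' j' => by
    rw [Subsingleton.elim i' 0, Subsingleton.elim j' 0]; rfl
  rw [Equiv.prodUnique_symm_apply, Equiv.prodUnique_symm_apply, Matrix.kroneckerMap_apply, hTW, mul_comm]

omit [NumberField F] in
/-- **the doubled Gram matrix is linear in `T`**: `gramD n (t • T) = t • gramD n T`. [cite: HarrisKudlaSweet1996, §1 (1.9)] -/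
theorem gramD_smul {n : ℕ} (t : F) (T₀ : Matrix (Fin n) (Fin n) F) : gramD F n (t • T₀) = t • gramD F n T₀ := by
  refine Matrix.ext fun i j => ?_
  simp only [gramD, Matrix.reindex_apply, Matrix.submatrix_apply, Matrix.smul_apply]
  rcases (e₂ n).symm i with a' | a' <;> rcases (e₂ n).symm j with b' | b' <;>
    simp [Matrix.fromBlocks, smul_eq_mul]

end Instances

end Literature.NumberTheory.GelbartRogawski1991.UnitaryDualPair.LocalSplitting

end
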